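import Summits.BirchSwinnertonDyer.Rank1Residual.X12.InertCoreRecords
import Summits.BirchSwinnertonDyer.Rank1Residual.X12.GoodTwistRecordsD7D8
import Summits.BirchSwinnertonDyer.Rank1Residual.X12.InertBadThreeInstancesB
import Summits.BirchSwinnertonDyer.Rank1Residual.X12.InertBadThreeInstancesC
import Summits.BirchSwinnertonDyer.Rank1Residual.X11b.ChaPairsMinimality
import Summits.BirchSwinnertonDyer.Rank1Residual.X11b.KrausMinimalityTwoUnit
import Summits.BirchSwinnertonDyer.BirchSwinnertonDyer.Theorems.Rank1ResidualX11RankOneMinimality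
import Literature.NumberTheory.EllipticCurves.NoEverywhereGoodReductionRat
import HarnessLib

/-!
# X12 inert-bad CORE (`p ≥ 5`): per-curve records (A) — route T-KR for
# `225a1@5`, `675a1@5`, `900c1@5`
# (cell `b2b-bsdres`, unit `b2b-bsdres-x1b`, gen 15)

HONEST FRAMING (cell `b2b-bsdres`, run/shared/lean/b2b/bsd-rank1-residual/, verbatim in every
file): the goal of the cell is to DELETE the COMBINATION-SHAPED residual classes of the
Birch–Swinnerton-Dyer formula for ALL analytic-rank `≤ 1` elliptic curves over `ℚ` — "full BSD
formula for every rank `≤ 1` curve in class `C`" assembled STRICTLY from published theorems — so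
that the rank-`≤ 1` remainder becomes exactly the CONSTRUCTION-SHAPED classes, which are TYPED
(missing-input `Prop`s), NOT attempted. This is not "finishing BSD". Unit `b2b-bsdres-x1b`
(CLASS-OWNERS row "X12 inert-bad core", prover owner), generation 15; research route, no claim
beyond the stated class; X12 REMAINS CONSTRUCTION-SHAPED at class level; nothing is booked here
(the lane books, the referee rules). PER-PAIR records in the style of
`X12/InertBadThreeInstances{A,B,C}.lean` (the `p = 3` inert-bad window, gen 12): definitions are
Cremona's minimal models (data), theorems only otherwise; no named fact.

THE CORE (harvest-1 g7; `HOME/b2b-bsdres-x1b/X12-ROUTE.md` §0): the 72 pairs `(E, p)` with `E/ℚ`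
CM of analytic rank one, `N_E < 2·10⁴`, `p ≥ 5`, `p ∣ N_E` (additive, potentially supersingular),
`p` INERT in the CM field `K` (`d_K ∈ {−3, −4, −7, −8}`; semistability defect `e ∈ {2, 3, 4, 6}`).
Each lies on the curve numbered `1` of one of the 84 classes of `cremonaCurveOneX12Core`
(Agashe–Ribet–Stein 2006 appendix Thm. 5.2 instance `ManinConstantX12Core.lean`, p207764). For each
the record `bsdp_<p>_<curve>` reads: PUBLISHED named facts (`hGZ … hCM8`, as in
`X12/InertCoreUpperHalf.lean`) + Cremona's two sentences (`h26 h52`: curve `1` optimal, Manin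
constant `1` for `N ≤ 130000`) + `r_an(E) = 1` + "`#Ш(E)_an = q ∈ ℚ` with `ord_p q = 0`" ⟹
`BSD(E, p)`, by ONE application of `X12.bsdp_of_mem_cremonaCurveOneX12Core_of_shaAn_unit`
(`X12/InertCoreRecords.lean`, p208318: Kolyvagin's bound in Matar–Nekovář's irreducible form over
a Friedberg–Hoffstein field ∘ Rubin/Burungale–Flach for the rank-0 CM twist; NO Heegner index, NO
descent, NO Tamagawa datum — `p ∤ ∏ c_ℓ` is a theorem for CM and `p ≥ 5`). KERNEL THEOREMS per
curve: elliptic and globally minimal (bounded Kraus/Silverman criterion by `decide`), BAD reduction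
at `p` from `p ∣ Δ_min` (Silverman VII.5 Prop. 5.1(a) via the tree's
`not_hasGoodReductionAtPrime_of_dvd_minimalDiscriminantInt`), `j ∈ {0, 1728, −3375, 8000}` hence
CM with `p ∤ d_K`, and membership in the list — packaged once per model family in §0 of part (A)
(`bsdp_of_eq_mordell` for `y² = x³ + k`, `bsdp_of_eq_mordell'` for `y² + y = x³ + k`,
`bsdp_of_eq_quartic` for `y² = x³ + Ax`). What is left per pair is exactly the lane's certified
data: `r_an = 1` and `ord_p #Ш_an = 0` (72/72: harvest-1 g13; this unit's `gen14/tkr5/TKR5-OFFER-995.tsv`,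
tier P for all 72). Models re-derived from `cremonaCurveOneX12Core` and re-checked (Δ, c₄, c₆, j,
`p ∣ Δ`, minimality pattern) by `HOME/code/b2b-bsdres-x1b/gen15/make_core_instances.py`
(+ `core72.json`). Curves already modelled in the tree are REUSED, not re-declared
(`GoodTwistRecords[D7D8]`, `FrobeniusIrrRecords`, `InertBadThreeInstances{B,C}`).
-/

set_option autoImplicit false

noncomputable section

open scoped Classical

open WeierstrassCurve IsDedekindDomain NumberField Rat.HeightOneSpectrum
  Literature.NumberTheory.EllipticCurves
  Literature.NumberTheory.EllipticCurves.ModularForms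
  Literature.NumberTheory.EllipticCurves.Rank1Residual
  Literature.NumberTheory.EllipticCurves.Rank1Residual.Typed
  Literature.NumberTheory.EllipticCurves.Rank1Residual.X11RankOneCertificates
  Literature.NumberTheory.EllipticCurves.AgasheRibetStein2006
  Literature.NumberTheory.Automorphic
  Summit.BirchSwinnertonDyer.BirchSwinnertonDyer.Rank1Residual.X11RankOne
  Summit.BirchSwinnertonDyer.Rank1Residual.X11b

namespace Summit.BirchSwinnertonDyer.Rank1Residual.X12

/-! ## §0 Kit: the class bits at a bad prime `p ≥ 5` read off the model, and one lemma per model family -/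

/-- `11` is prime. [folklore] -/
instance Records.fact_prime_eleven : Fact (Nat.Prime 11) := ⟨by norm_num⟩

/-- `17` is prime. [folklore] -/
instance Records.fact_prime_seventeen : Fact (Nat.Prime 17) := ⟨by norm_num⟩

/-- **`ClassX12 W p` from CM + analytic rank one + BAD reduction at `p`** (the last clause of the
class predicate `ClassX12`, RESIDUAL-CASES §a.2 row X12). [folklore] -/
theorem classX12_of_hasCM_of_not_good (W : WeierstrassCurve ℚ) [W.IsElliptic] (p : ℕ) [Fact p.Prime]
    (hCM : W.HasCM) (hr : W.analyticRank = 1) (hbad : ¬ Good W p) : ClassX12 W p :=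
  ⟨hCM, hr, Or.inr (Or.inr (Or.inr hbad))⟩

/-- **Bad reduction read off a globally minimal model**: `W.Δ = D ∈ ℤ` with `p ∣ D` ⟹ `¬ good(p)`
(a minimal equation has good reduction iff `v(Δ) = 0`; tree
`not_hasGoodReductionAtPrime_of_dvd_minimalDiscriminantInt`). [cite: SilvermanAEC2009, VII.5 Prop. 5.1(a)] -/
theorem not_good_of_Δ_eq (W : WeierstrassCurve ℚ) [W.IsGloballyMinimal] (p : ℕ) [Fact p.Prime]
    {D : ℤ} (hΔ : W.Δ = D) (hdvd : (p : ℤ) ∣ D) : ¬ Good W p := by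
  refine not_hasGoodReductionAtPrime_of_dvd_minimalDiscriminantInt W p ?_
  have h : (minimalDiscriminantInt W : ℚ) = (D : ℚ) := by rw [cast_minimalDiscriminantInt, hΔ]
  rwa [Int.cast_inj.mp h]

/-- `j = 0` when `c₄ = 0` (`j = c₄³/Δ`). [cite: SilvermanAEC2009, III.1] -/
theorem j_eq_zero_of_c₄_eq_zero (W : WeierstrassCurve ℚ) [W.IsElliptic] (h : W.c₄ = 0) : W.j = 0 := by
  rw [j, h]; ring

/-- `j = 1728` when `c₆ = 0` (`c₄³ = c₆² + 1728Δ`). [cite: SilvermanAEC2009, III.1] -/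
theorem j_eq_1728_of_c₆_eq_zero (W : WeierstrassCurve ℚ) [W.IsElliptic] (h : W.c₆ = 0) :
    W.j = 1728 := by
  have hrel := W.c_relation
  rw [h] at hrel
  rw [j, Units.inv_mul_eq_iff_eq_mul, coe_Δ']
  linear_combination -hrel

/-- A prime `p ≥ 5` divides none of `3, 4, 7·k?` — here: `p ∤ m` for `0 < m < 5`. [folklore] -/
theorem not_intCast_dvd_of_five_le {p : ℕ} (hp5 : 5 ≤ p) {m : ℕ} (hm0 : 0 < m) (hm : m < 5) :
    ¬ (p : ℤ) ∣ (m : ℤ) := by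
  intro h
  have h' : p ∣ m := by exact_mod_cast h
  have := Nat.le_of_dvd hm0 h'
  omega

/-- `j = 0` ⟹ CM field `ℚ(√−3)`: unramified at every prime `p ∤ 3`. [folklore] -/
theorem not_cmRamified_of_j_eq_zero (W : WeierstrassCurve ℚ) [W.IsElliptic] (hj : W.j = 0) (p : ℕ)
    (hp : ¬ (p : ℤ) ∣ 3) : ¬ CMRamified W p := by
  unfold CMRamified; rw [hj]; norm_num [cmFieldDiscrOfJ]; exact hp

/-- `j = 1728` ⟹ CM field `ℚ(i)`: unramified at every prime `p ∤ 4`. [folklore] -/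
theorem not_cmRamified_of_j_eq_1728 (W : WeierstrassCurve ℚ) [W.IsElliptic] (hj : W.j = 1728)
    (p : ℕ) (hp : ¬ (p : ℤ) ∣ 4) : ¬ CMRamified W p := by
  unfold CMRamified; rw [hj]; norm_num [cmFieldDiscrOfJ]; exact hp

/-- `j = −3375` ⟹ CM field `ℚ(√−7)`: unramified at every prime `p ∤ 7`. [folklore] -/
theorem not_cmRamified_of_j_eq_neg3375 (W : WeierstrassCurve ℚ) [W.IsElliptic] (hj : W.j = -3375)
    (p : ℕ) (hp : ¬ (p : ℤ) ∣ 7) : ¬ CMRamified W p := by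
  unfold CMRamified; rw [hj]; norm_num [cmFieldDiscrOfJ]; exact hp

/-- `j = 8000` ⟹ CM field `ℚ(√−2)`: unramified at every prime `p ∤ 8`. [folklore] -/
theorem not_cmRamified_of_j_eq_8000 (W : WeierstrassCurve ℚ) [W.IsElliptic] (hj : W.j = 8000)
    (p : ℕ) (hp : ¬ (p : ℤ) ∣ 8) : ¬ CMRamified W p := by
  unfold CMRamified; rw [hj]; norm_num [cmFieldDiscrOfJ]; exact hp

/-- The Mordell model `y² = x³ + k`: `Δ = −432k²`, `c₄ = 0`. [cite: SilvermanAEC2009, III.1] -/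
theorem Δ_c₄_mordell (k : ℚ) : (⟨0, 0, 0, 0, k⟩ : WeierstrassCurve ℚ).Δ = -(432 * k ^ 2) ∧
    (⟨0, 0, 0, 0, k⟩ : WeierstrassCurve ℚ).c₄ = 0 := by
  constructor
  · simp only [WeierstrassCurve.Δ, WeierstrassCurve.b₂, WeierstrassCurve.b₄, WeierstrassCurve.b₆,
      WeierstrassCurve.b₈]; ring
  · simp only [WeierstrassCurve.c₄, WeierstrassCurve.b₂, WeierstrassCurve.b₄]; ring

/-- The model `y² + y = x³ + k` (`j = 0`): `Δ = −27(4k+1)²`, `c₄ = 0`. [cite: SilvermanAEC2009, III.1] -/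
theorem Δ_c₄_mordell' (k : ℚ) : (⟨0, 0, 1, 0, k⟩ : WeierstrassCurve ℚ).Δ = -(27 * (4 * k + 1) ^ 2) ∧
    (⟨0, 0, 1, 0, k⟩ : WeierstrassCurve ℚ).c₄ = 0 := by
  constructor
  · simp only [WeierstrassCurve.Δ, WeierstrassCurve.b₂, WeierstrassCurve.b₄, WeierstrassCurve.b₆,
      WeierstrassCurve.b₈]; ring
  · simp only [WeierstrassCurve.c₄, WeierstrassCurve.b₂, WeierstrassCurve.b₄]; ring

/-- The model `y² = x³ + Ax` (`j = 1728`): `Δ = −64A³`, `c₆ = 0`. [cite: SilvermanAEC2009, III.1] -/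
theorem Δ_c₆_quartic (A : ℚ) : (⟨0, 0, 0, A, 0⟩ : WeierstrassCurve ℚ).Δ = -(64 * A ^ 3) ∧
    (⟨0, 0, 0, A, 0⟩ : WeierstrassCurve ℚ).c₆ = 0 := by
  constructor
  · simp only [WeierstrassCurve.Δ, WeierstrassCurve.b₂, WeierstrassCurve.b₄, WeierstrassCurve.b₆,
      WeierstrassCurve.b₈]; ring
  · simp only [WeierstrassCurve.c₆, WeierstrassCurve.b₂, WeierstrassCurve.b₄, WeierstrassCurve.b₆]; ring

/-- **Route T-KR on a listed Mordell model `W = (y² = x³ + k)`** (`j = 0`, CM by `ℤ[ζ₃]`): for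
`(W, N) ∈ cremonaCurveOneX12Core`, `W` globally minimal, a prime `p ≥ 5` with `p ∣ Δ(W) = −432k²`
(so `W` is BAD at `p`, and `p ∤ d_K = −3`): PUBLISHED facts + Cremona's two sentences + `r_an = 1`
+ "`#Ш_an = q`, `ord_p q = 0`" ⟹ `BSD(W, p)` — one application of
`bsdp_of_mem_cremonaCurveOneX12Core_of_shaAn_unit`. [cite: MatarNekovar2019, Thm. 0.3 and §0.11]
[cite: AgasheRibetStein2006, Thm. 2.6 and appendix Thm. 5.2] [cite: Miller2011LMS, Def. 1.1] -/
theorem bsdp_of_eq_mordell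
    (hGZ : ∀ (N : ℕ) [NeZero N] (W : WeierstrassCurve ℚ) (K : Type) [Field K] [NumberField K],
      gross_zagier N W K)
    (hKo : ∀ (N : ℕ) [NeZero N] (W : WeierstrassCurve ℚ) (K : Type) [Field K] [NumberField K],
      kolyvagin N W K)
    (hMN : ∀ (N : ℕ) [NeZero N] (W : WeierstrassCurve ℚ) (K : Type) [Field K] [NumberField K],
      MatarNekovar2019.thm03_padicValNat_card_sha_le_of_irreducible N W K)
    (hGZK : rank_eq_analyticRank_of_analyticRank_le_one) (hmod : hasEntireLFunction_rat)
    (hnf : exists_isNewformOf) (hFH : friedbergHoffstein_exists_heegnerField_split_twist_ne_zero)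
    (hCM8 : bsdTriple_of_hasCM_of_L_one_ne_zero)
    (h26 : cremona_abs_maninConstant_eq_one_of_level_le) (h52 : cremona_optimal_curveOne_x12Core)
    (W : WeierstrassCurve ℚ) [W.IsElliptic] [W.IsGloballyMinimal] (k : ℚ) (hW : W = ⟨0, 0, 0, 0, k⟩)
    (N : ℕ) [NeZero N] (hmem : (W, N) ∈ cremonaCurveOneX12Core) (p : ℕ) [Fact p.Prime] (hp5 : 5 ≤ p)
    (D : ℤ) (hD : -(432 * k ^ 2) = (D : ℚ)) (hpD : (p : ℤ) ∣ D) (hr : W.analyticRank = 1)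
    {q : ℚ} (hq : shaAn W = (q : ℂ)) (hv : padicValRat p q = 0) : BSDp W p := by
  have hΔ : W.Δ = D := by rw [hW, (Δ_c₄_mordell k).1, hD]
  have hj : W.j = 0 := j_eq_zero_of_c₄_eq_zero W (by rw [hW]; exact (Δ_c₄_mordell k).2)
  exact bsdp_of_mem_cremonaCurveOneX12Core_of_shaAn_unit hGZ hKo hMN hGZK hmod hnf hFH hCM8 h26 h52
    W N hmem p (classX12_of_hasCM_of_not_good W p (hasCM_of_j_eq_zero W hj) hr
      (not_good_of_Δ_eq W p hΔ hpD)) hp5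
    (not_cmRamified_of_j_eq_zero W hj p (not_intCast_dvd_of_five_le hp5 (by norm_num) (by norm_num)))
    hq hv

/-- **Route T-KR on a listed model `W = (y² + y = x³ + k)`** (`j = 0`): as `bsdp_of_eq_mordell` with
`Δ(W) = −27(4k+1)²`. [cite: MatarNekovar2019, Thm. 0.3 and §0.11]
[cite: AgasheRibetStein2006, Thm. 2.6 and appendix Thm. 5.2] [cite: Miller2011LMS, Def. 1.1] -/
theorem bsdp_of_eq_mordell'
    (hGZ : ∀ (N : ℕ) [NeZero N] (W : WeierstrassCurve ℚ) (K : Type) [Field K] [NumberField K],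
      gross_zagier N W K)
    (hKo : ∀ (N : ℕ) [NeZero N] (W : WeierstrassCurve ℚ) (K : Type) [Field K] [NumberField K],
      kolyvagin N W K)
    (hMN : ∀ (N : ℕ) [NeZero N] (W : WeierstrassCurve ℚ) (K : Type) [Field K] [NumberField K],
      MatarNekovar2019.thm03_padicValNat_card_sha_le_of_irreducible N W K)
    (hGZK : rank_eq_analyticRank_of_analyticRank_le_one) (hmod : hasEntireLFunction_rat)
    (hnf : exists_isNewformOf) (hFH : friedbergHoffstein_exists_heegnerField_split_twist_ne_zero)
    (hCM8 : bsdTriple_of_hasCM_of_L_one_ne_zero)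
    (h26 : cremona_abs_maninConstant_eq_one_of_level_le) (h52 : cremona_optimal_curveOne_x12Core)
    (W : WeierstrassCurve ℚ) [W.IsElliptic] [W.IsGloballyMinimal] (k : ℚ) (hW : W = ⟨0, 0, 1, 0, k⟩)
    (N : ℕ) [NeZero N] (hmem : (W, N) ∈ cremonaCurveOneX12Core) (p : ℕ) [Fact p.Prime] (hp5 : 5 ≤ p)
    (D : ℤ) (hD : -(27 * (4 * k + 1) ^ 2) = (D : ℚ)) (hpD : (p : ℤ) ∣ D) (hr : W.analyticRank = 1)
    {q : ℚ} (hq : shaAn W = (q : ℂ)) (hv : padicValRat p q = 0) : BSDp W p := by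
  have hΔ : W.Δ = D := by rw [hW, (Δ_c₄_mordell' k).1, hD]
  have hj : W.j = 0 := j_eq_zero_of_c₄_eq_zero W (by rw [hW]; exact (Δ_c₄_mordell' k).2)
  exact bsdp_of_mem_cremonaCurveOneX12Core_of_shaAn_unit hGZ hKo hMN hGZK hmod hnf hFH hCM8 h26 h52
    W N hmem p (classX12_of_hasCM_of_not_good W p (hasCM_of_j_eq_zero W hj) hr
      (not_good_of_Δ_eq W p hΔ hpD)) hp5
    (not_cmRamified_of_j_eq_zero W hj p (not_intCast_dvd_of_five_le hp5 (by norm_num) (by norm_num)))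
    hq hv

/-- **Route T-KR on a listed model `W = (y² = x³ + Ax)`** (`j = 1728`, CM by `ℤ[i]`, `p ∤ d_K = −4`):
as `bsdp_of_eq_mordell` with `Δ(W) = −64A³`. [cite: MatarNekovar2019, Thm. 0.3 and §0.11]
[cite: AgasheRibetStein2006, Thm. 2.6 and appendix Thm. 5.2] [cite: Miller2011LMS, Def. 1.1] -/
theorem bsdp_of_eq_quartic
    (hGZ : ∀ (N : ℕ) [NeZero N] (W : WeierstrassCurve ℚ) (K : Type) [Field K] [NumberField K],
      gross_zagier N W K)
    (hKo : ∀ (N : ℕ) [NeZero N] (W : WeierstrassCurve ℚ) (K : Type) [Field K] [NumberField K],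
      kolyvagin N W K)
    (hMN : ∀ (N : ℕ) [NeZero N] (W : WeierstrassCurve ℚ) (K : Type) [Field K] [NumberField K],
      MatarNekovar2019.thm03_padicValNat_card_sha_le_of_irreducible N W K)
    (hGZK : rank_eq_analyticRank_of_analyticRank_le_one) (hmod : hasEntireLFunction_rat)
    (hnf : exists_isNewformOf) (hFH : friedbergHoffstein_exists_heegnerField_split_twist_ne_zero)
    (hCM8 : bsdTriple_of_hasCM_of_L_one_ne_zero)
    (h26 : cremona_abs_maninConstant_eq_one_of_level_le) (h52 : cremona_optimal_curveOne_x12Core)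
    (W : WeierstrassCurve ℚ) [W.IsElliptic] [W.IsGloballyMinimal] (A : ℚ) (hW : W = ⟨0, 0, 0, A, 0⟩)
    (N : ℕ) [NeZero N] (hmem : (W, N) ∈ cremonaCurveOneX12Core) (p : ℕ) [Fact p.Prime] (hp5 : 5 ≤ p)
    (D : ℤ) (hD : -(64 * A ^ 3) = (D : ℚ)) (hpD : (p : ℤ) ∣ D) (hr : W.analyticRank = 1)
    {q : ℚ} (hq : shaAn W = (q : ℂ)) (hv : padicValRat p q = 0) : BSDp W p := by
  have hΔ : W.Δ = D := by rw [hW, (Δ_c₆_quartic A).1, hD]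
  have hj : W.j = 1728 := j_eq_1728_of_c₆_eq_zero W (by rw [hW]; exact (Δ_c₆_quartic A).2)
  exact bsdp_of_mem_cremonaCurveOneX12Core_of_shaAn_unit hGZ hKo hMN hGZK hmod hnf hFH hCM8 h26 h52
    W N hmem p (classX12_of_hasCM_of_not_good W p (hasCM_of_j_eq_1728 W hj) hr
      (not_good_of_Δ_eq W p hΔ hpD)) hp5
    (not_cmRamified_of_j_eq_1728 W hj p (not_intCast_dvd_of_five_le hp5 (by norm_num) (by norm_num)))
    hq hv

/-! ## §1 The curves: models, ellipticity, global minimality, membership -/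

namespace Records

/-- Cremona `225a1 = [0, 0, 1, 0, 1]`: `y² + y = x³ + 1` (`N = 225 = 3²·5²`, `j = 0`,
CM by `ℤ[ζ₃]`, `5` INERT in `K`; `Δ = −3³·5²`, `ord_{5} Δ = 2`; core pair
at `p = 5`, `e = 6`). [cite: Cremona1997, Table 1 (curve 225a1)] -/
def c225a1 : WeierstrassCurve ℚ := ⟨0, 0, 1, 0, 1⟩

/-- `225a1` is an elliptic curve (`Δ ≠ 0`). [cite: SilvermanAEC2009, III.1] -/
instance isElliptic_c225a1 : c225a1.IsElliptic := by
  have h := isElliptic_of_discOf_ne_zero 0 0 1 0 1 (by decide); norm_num at h; exact h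

set_option maxRecDepth 100000 in
/-- `[0, 0, 1, 0, 1]` is globally minimal (Silverman/Kraus bounded criterion; kernel-decided).
[cite: SilvermanAEC2009, VII.1 Remark 1.1] [cite: Kraus1989, Prop. 2] -/
instance isGloballyMinimal_c225a1 : c225a1.IsGloballyMinimal := by
  have h := isGloballyMinimal_of_krausCriterion_bounded 0 0 1 0 1 (by decide) (by decide)
    (by decide +kernel)
  norm_num at h; exact h

/-- `(225a1, 225)` is listed in `cremonaCurveOneX12Core`. [cite: AgasheRibetStein2006, appendix Thm. 5.2] -/
theorem mem_c225a1 : (c225a1, 225) ∈ cremonaCurveOneX12Core := by simp [cremonaCurveOneX12Core, c225a1]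

/-- Cremona `675a1 = [0, 0, 1, 0, 31]`: `y² + y = x³ + 31` (`N = 675 = 3³·5²`, `j = 0`,
CM by `ℤ[ζ₃]`, `5` INERT in `K`; `Δ = −3³·5⁶`, `ord_{5} Δ = 6`; core pair
at `p = 5`, `e = 2`). [cite: Cremona1997, Table 1 (curve 675a1)] -/
def c675a1 : WeierstrassCurve ℚ := ⟨0, 0, 1, 0, 31⟩

/-- `675a1` is an elliptic curve (`Δ ≠ 0`). [cite: SilvermanAEC2009, III.1] -/
instance isElliptic_c675a1 : c675a1.IsElliptic := by
  have h := isElliptic_of_discOf_ne_zero 0 0 1 0 31 (by decide); norm_num at h; exact h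

set_option maxRecDepth 100000 in
/-- `[0, 0, 1, 0, 31]` is globally minimal (Silverman/Kraus bounded criterion; kernel-decided).
[cite: SilvermanAEC2009, VII.1 Remark 1.1] [cite: Kraus1989, Prop. 2] -/
instance isGloballyMinimal_c675a1 : c675a1.IsGloballyMinimal := by
  have h := isGloballyMinimal_of_krausCriterion_bounded 0 0 1 0 31 (by decide) (by decide)
    (by decide +kernel)
  norm_num at h; exact h

/-- `(675a1, 675)` is listed in `cremonaCurveOneX12Core`. [cite: AgasheRibetStein2006, appendix Thm. 5.2] -/
theorem mem_c675a1 : (c675a1, 675) ∈ cremonaCurveOneX12Core := by simp [cremonaCurveOneX12Core, c675a1]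

/-- Cremona `900c1 = [0, 0, 0, 0, 100]`: `y² = x³ + 100` (`N = 900 = 2²·3²·5²`, `j = 0`,
CM by `ℤ[ζ₃]`, `5` INERT in `K`; `Δ = −2⁸·3³·5⁴`, `ord_{5} Δ = 4`; core pair
at `p = 5`, `e = 3`). [cite: Cremona1997, Table 1 (curve 900c1)] -/
def c900c1 : WeierstrassCurve ℚ := ⟨0, 0, 0, 0, 100⟩

/-- `900c1` is an elliptic curve (`Δ ≠ 0`). [cite: SilvermanAEC2009, III.1] -/
instance isElliptic_c900c1 : c900c1.IsElliptic := by
  have h := isElliptic_of_discOf_ne_zero 0 0 0 0 100 (by decide); norm_num at h; exact h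

set_option maxRecDepth 100000 in
/-- `[0, 0, 0, 0, 100]` is globally minimal (Silverman/Kraus bounded criterion; kernel-decided).
[cite: SilvermanAEC2009, VII.1 Remark 1.1] [cite: Kraus1989, Prop. 2] -/
instance isGloballyMinimal_c900c1 : c900c1.IsGloballyMinimal := by
  have h := isGloballyMinimal_of_krausCriterion_bounded 0 0 0 0 100 (by decide) (by decide)
    (by decide +kernel)
  norm_num at h; exact h

/-- `(900c1, 900)` is listed in `cremonaCurveOneX12Core`. [cite: AgasheRibetStein2006, appendix Thm. 5.2] -/
theorem mem_c900c1 : (c900c1, 900) ∈ cremonaCurveOneX12Core := by simp [cremonaCurveOneX12Core, c900c1]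

end Records

/-! ## §2 The records -/

section Facts

/-! The PUBLISHED named facts (as in `X12/InertCoreUpperHalf.lean`) and Cremona's two sentences. -/
variable
    (hGZ : ∀ (N : ℕ) [NeZero N] (W : WeierstrassCurve ℚ) (K : Type) [Field K] [NumberField K],
      gross_zagier N W K)
    (hKo : ∀ (N : ℕ) [NeZero N] (W : WeierstrassCurve ℚ) (K : Type) [Field K] [NumberField K],
      kolyvagin N W K)
    (hMN : ∀ (N : ℕ) [NeZero N] (W : WeierstrassCurve ℚ) (K : Type) [Field K] [NumberField K],
      MatarNekovar2019.thm03_padicValNat_card_sha_le_of_irreducible N W K)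
    (hGZK : rank_eq_analyticRank_of_analyticRank_le_one) (hmod : hasEntireLFunction_rat)
    (hnf : exists_isNewformOf) (hFH : friedbergHoffstein_exists_heegnerField_split_twist_ne_zero)
    (hCM8 : bsdTriple_of_hasCM_of_L_one_ne_zero)
    (h26 : cremona_abs_maninConstant_eq_one_of_level_le) (h52 : cremona_optimal_curveOne_x12Core)

include hGZ hKo hMN hGZK hmod hnf hFH hCM8 h26 h52

/-- **RECORD `225a1 @ 5`** (T-KR; core pair, `e = 6`, `j = 0`, `5 ∤ d_K = -3`,
`5 ∣ Δ_min`): PUBLISHED facts + Cremona's Manin table + `r_an = 1` + `ord_{5} #Ш_an = 0` ⟹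
`BSD(225a1, 5)`. PER PAIR; nothing booked. [cite: MatarNekovar2019, Thm. 0.3 and §0.11]
[cite: AgasheRibetStein2006, Thm. 2.6 and appendix Thm. 5.2] [cite: Miller2011LMS, Def. 1.1] -/
theorem bsdp_5_c225a1 (hr : Records.c225a1.analyticRank = 1)
    {q : ℚ} (hq : shaAn Records.c225a1 = (q : ℂ)) (hv : padicValRat 5 q = 0) :
    BSDp Records.c225a1 5 :=
  bsdp_of_eq_mordell' hGZ hKo hMN hGZK hmod hnf hFH hCM8 h26 h52 Records.c225a1 1 rfl 225
    Records.mem_c225a1 5 (by norm_num) (-675) (by norm_num) (by norm_num) hr hq hv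

/-- **RECORD `675a1 @ 5`** (T-KR; core pair, `e = 2`, `j = 0`, `5 ∤ d_K = -3`,
`5 ∣ Δ_min`): PUBLISHED facts + Cremona's Manin table + `r_an = 1` + `ord_{5} #Ш_an = 0` ⟹
`BSD(675a1, 5)`. PER PAIR; nothing booked. [cite: MatarNekovar2019, Thm. 0.3 and §0.11]
[cite: AgasheRibetStein2006, Thm. 2.6 and appendix Thm. 5.2] [cite: Miller2011LMS, Def. 1.1] -/
theorem bsdp_5_c675a1 (hr : Records.c675a1.analyticRank = 1)
    {q : ℚ} (hq : shaAn Records.c675a1 = (q : ℂ)) (hv : padicValRat 5 q = 0) :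
    BSDp Records.c675a1 5 :=
  bsdp_of_eq_mordell' hGZ hKo hMN hGZK hmod hnf hFH hCM8 h26 h52 Records.c675a1 31 rfl 675
    Records.mem_c675a1 5 (by norm_num) (-421875) (by norm_num) (by norm_num) hr hq hv

/-- **RECORD `900c1 @ 5`** (T-KR; core pair, `e = 3`, `j = 0`, `5 ∤ d_K = -3`,
`5 ∣ Δ_min`): PUBLISHED facts + Cremona's Manin table + `r_an = 1` + `ord_{5} #Ш_an = 0` ⟹
`BSD(900c1, 5)`. PER PAIR; nothing booked. [cite: MatarNekovar2019, Thm. 0.3 and §0.11]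
[cite: AgasheRibetStein2006, Thm. 2.6 and appendix Thm. 5.2] [cite: Miller2011LMS, Def. 1.1] -/
theorem bsdp_5_c900c1 (hr : Records.c900c1.analyticRank = 1)
    {q : ℚ} (hq : shaAn Records.c900c1 = (q : ℂ)) (hv : padicValRat 5 q = 0) :
    BSDp Records.c900c1 5 :=
  bsdp_of_eq_mordell hGZ hKo hMN hGZK hmod hnf hFH hCM8 h26 h52 Records.c900c1 100 rfl 900
    Records.mem_c900c1 5 (by norm_num) (-4320000) (by norm_num) (by norm_num) hr hq hv

end Facts

end Summit.BirchSwinnertonDyer.Rank1Residual.X12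

end
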